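import Literature.NumberTheory.GaloisRepresentations.UnramifiedFrameRing
import Mathlib.RingTheory.Polynomial.Subring
import Mathlib.Algebra.Polynomial.Reverse
import HarnessLib

/-!
# `ℚ̄_p`-points of local `𝒪_L`-algebras: automatic integrality and continuity estimates

Let `L/ℚ_p` be finite inside `ℚ̄_p`, `𝒪 = 𝒪_L`, and `x : R → ℚ̄_p` an `𝒪`-algebra homomorphism
from a LOCAL `𝒪`-algebra `R` (with `ℚ̄_p` an `𝒪`-algebra through `𝒪 ⊆ L ⊆ ℚ̄_p`).  The basic
rigidity behind "a `ℚ̄_p`-point of a complete local `𝒪`-algebra is `𝒪_{ℚ̄_p}`-valued and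
continuous" ([BLGGT] §1.2; de Jong 1995, 7.1.9) is PROVED here in elementary form:

* `exists_monic_aeval_eq_zero_of_norm_le_one` — an element of `ℚ̄_p` of norm `≤ 1` is integral
  over `𝒪_L` (its minimal polynomial over `ℚ_p` has coefficients of norm `≤ 1` by the spectral
  value formula, Mathlib `spectralValue_le_one_iff`);
* `norm_map_lt_one_of_mem_maximalIdeal` — **`x(𝔪_R) ⊆ 𝔪_{ℚ̄_p}`**: if `‖x m‖ ≥ 1` for some
  `m ∈ 𝔪_R`, the reversed integral polynomial of `(x m)⁻¹` gives a unit `1 + m(…)` of `R` mapping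
  to `0`;
* `norm_map_le_one` — `x(R) ⊆ 𝒪_{ℚ̄_p}` when `R = 𝒪 + 𝔪_R`;
* for `R = frameRing L n = 𝒪⟦X_{ij}⟧`: generators of the maximal ideal
  (`maximalIdeal_frameRing_eq_span`), and the **continuity estimate**
  `exists_norm_map_pow_le`: there is `c < 1` with `‖x a‖ ≤ cᴺ` for all `a ∈ 𝔪ᴺ`.

No named facts, no `sorry`.

## References

* [BLGGT] T. Barnet-Lamb, T. Gee, D. Geraghty, R. Taylor, Ann. of Math. 179 (2014), §1.2.
  [BarnetlambEtAl2014]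
* A. J. de Jong, *Crystalline Dieudonné module theory via formal and rigid geometry*, Publ. IHÉS 82
  (1995), Lemma 7.1.9.
-/

noncomputable section

open IsLocalRing Polynomial

namespace Literature.NumberTheory.GaloisRepresentations

variable {p : ℕ} [Fact p.Prime] (L : IntermediateField ℚ_[p] (PadicAlgCl p))

/-! ### Integrality of the unit ball of `ℚ̄_p` over `𝒪_L` -/

section Integrality

variable [Algebra (intermediateFieldIntegers p L) (PadicAlgCl p)]
  [IsScalarTower (intermediateFieldIntegers p L) L (PadicAlgCl p)]

/-- The structure map `𝒪_L → ℚ̄_p` is the inclusion. [folklore] -/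
theorem algebraMap_integers_padicAlgCl_apply (a : intermediateFieldIntegers p L) :
    algebraMap (intermediateFieldIntegers p L) (PadicAlgCl p) a = ((a : L) : PadicAlgCl p) := by
  rw [IsScalarTower.algebraMap_apply (intermediateFieldIntegers p L) L (PadicAlgCl p)]
  rfl

/-- `‖algebraMap 𝒪_L ℚ̄_p a‖ ≤ 1`. [folklore] -/
theorem norm_algebraMap_integers_le_one (a : intermediateFieldIntegers p L) :
    ‖algebraMap (intermediateFieldIntegers p L) (PadicAlgCl p) a‖ ≤ 1 := by
  rw [algebraMap_integers_padicAlgCl_apply, ← intermediateFieldIntegers.norm_coe]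
  exact intermediateFieldIntegers.norm_le_one L a

/-- The map `{a ∈ ℚ_p : ‖a‖ ≤ 1} → 𝒪_L`. [folklore] -/
def padicUnitBallToIntegers : PadicInt.subring p →+* intermediateFieldIntegers p L where
  toFun a := ⟨algebraMap ℚ_[p] L a, by
    rw [intermediateFieldIntegers.mem_iff_norm_le_one, intermediateFieldIntegers.norm_coe,
      show ((algebraMap ℚ_[p] L (a : ℚ_[p]) : L) : PadicAlgCl p) = algebraMap ℚ_[p] (PadicAlgCl p) a from
        (IsScalarTower.algebraMap_apply ℚ_[p] L (PadicAlgCl p) _).symm,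
      norm_algebraMap', ← PadicInt.mem_subring_iff p]
    exact a.2⟩
  map_one' := Subtype.ext (by simp)
  map_mul' a b := Subtype.ext (by simp)
  map_zero' := Subtype.ext (by simp)
  map_add' a b := Subtype.ext (by simp)

/-- Compatibility of `padicUnitBallToIntegers` with the maps to `ℚ̄_p`. [folklore] -/
theorem algebraMap_comp_padicUnitBallToIntegers :
    (algebraMap (intermediateFieldIntegers p L) (PadicAlgCl p)).comp (padicUnitBallToIntegers L) =
      (algebraMap ℚ_[p] (PadicAlgCl p)).comp (PadicInt.subring p).subtype := by
  ext a
  rw [RingHom.comp_apply, RingHom.comp_apply, algebraMap_integers_padicAlgCl_apply]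
  exact (IsScalarTower.algebraMap_apply ℚ_[p] L (PadicAlgCl p) _).symm

/-- **The closed unit ball of `ℚ̄_p` is integral over `𝒪_L`**: an element of norm `≤ 1` is a root
of a monic polynomial with coefficients in `𝒪_L` (the minimal polynomial over `ℚ_p` has
coefficients of norm `≤ 1`, by the spectral value formula for the norm of `ℚ̄_p`). [folklore] -/
theorem exists_monic_aeval_eq_zero_of_norm_le_one (z : PadicAlgCl p) (hz : ‖z‖ ≤ 1) :
    ∃ h : Polynomial (intermediateFieldIntegers p L), h.Monic ∧ Polynomial.aeval z h = 0 := by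
  set P := minpoly ℚ_[p] z with hP
  have hPm : P.Monic := minpoly.monic (Algebra.IsAlgebraic.isAlgebraic z).isIntegral
  have hval : spectralValue P ≤ 1 := by
    change spectralNorm ℚ_[p] (PadicAlgCl p) z ≤ 1
    rw [PadicAlgCl.spectralNorm_eq]
    exact hz
  have hcoeff : ∀ k, ‖P.coeff k‖ ≤ 1 := (spectralValue_le_one_iff hPm).1 hval
  have hPT : (↑P.coeffs : Set ℚ_[p]) ⊆ PadicInt.subring p := fun c hc => by
    obtain ⟨k, -, rfl⟩ := Polynomial.mem_coeffs_iff.1 hc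
    exact (PadicInt.mem_subring_iff p).2 (hcoeff k)
  refine ⟨(P.toSubring _ hPT).map (padicUnitBallToIntegers L), ((Polynomial.monic_toSubring _ _ _).2 hPm).map _, ?_⟩
  rw [Polynomial.aeval_def, Polynomial.eval₂_map, algebraMap_comp_padicUnitBallToIntegers, ← Polynomial.eval₂_map,
    Polynomial.map_toSubring, ← Polynomial.aeval_def]
  exact minpoly.aeval ℚ_[p] z

end Integrality

/-! ### `x(𝔪_R) ⊆ 𝔪_{ℚ̄_p}` for points of local `𝒪_L`-algebras -/

section Local

variable [Algebra (intermediateFieldIntegers p L) (PadicAlgCl p)]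
  [IsScalarTower (intermediateFieldIntegers p L) L (PadicAlgCl p)]
  {R : Type*} [CommRing R] [IsLocalRing R] [Algebra (intermediateFieldIntegers p L) R]

/-- **A `ℚ̄_p`-point of a local `𝒪_L`-algebra maps the maximal ideal into the open unit ball.**
If `‖x m‖ ≥ 1` with `m ∈ 𝔪_R`, let `h ∈ 𝒪_L[Y]` be monic with `h((x m)⁻¹) = 0`
(`exists_monic_aeval_eq_zero_of_norm_le_one`); its reverse `Q` has `Q(0) = 1` and `Q(x m) = 0`,
so `Q(m) ∈ 1 + 𝔪_R` is a unit of `R` with `x(Q(m)) = 0`, absurd. [cite: BarnetlambEtAl2014, §1.2] -/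
theorem norm_map_lt_one_of_mem_maximalIdeal (x : R →ₐ[intermediateFieldIntegers p L] PadicAlgCl p)
    {m : R} (hm : m ∈ maximalIdeal R) : ‖x m‖ < 1 := by
  by_contra hlt
  have h1 : 1 ≤ ‖x m‖ := not_lt.1 hlt
  have hs0 : x m ≠ 0 := fun h => by
    rw [h, norm_zero] at h1
    exact absurd h1 (by norm_num)
  have ht : ‖(x m)⁻¹‖ ≤ 1 := by
    rw [norm_inv]
    exact inv_le_one_of_one_le₀ h1
  obtain ⟨h, hmon, hroot⟩ := exists_monic_aeval_eq_zero_of_norm_le_one L (x m)⁻¹ ht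
  haveI : Invertible (x m)⁻¹ := invertibleOfNonzero (inv_ne_zero hs0)
  have hQ : Polynomial.aeval (x m) h.reverse = 0 := by
    have h2 := (Polynomial.eval₂_reverse_eq_zero_iff (algebraMap (intermediateFieldIntegers p L) (PadicAlgCl p))
      (x m)⁻¹ h).2 (by rwa [Polynomial.aeval_def] at hroot)
    rwa [invOf_eq_inv, inv_inv, ← Polynomial.aeval_def] at h2
  -- `r := Q(m)` is a unit of `R`
  have hr1 : Polynomial.aeval m h.reverse - 1 ∈ maximalIdeal R := by
    have hc : h.reverse.coeff 0 = 1 := by rw [Polynomial.coeff_zero_reverse, hmon.leadingCoeff]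
    obtain ⟨q, hq⟩ : Polynomial.X ∣ h.reverse - Polynomial.C 1 := by
      rw [Polynomial.X_dvd_iff, Polynomial.coeff_sub, hc, Polynomial.coeff_C_zero, sub_self]
    have h3 : Polynomial.aeval m h.reverse - 1 = m * Polynomial.aeval m q := by
      have h4 := congrArg (Polynomial.aeval m) hq
      rw [map_sub, map_mul, Polynomial.aeval_X, Polynomial.aeval_C, map_one] at h4
      exact h4
    rw [h3]
    exact Ideal.mul_mem_right _ _ hm
  have hru : IsUnit (Polynomial.aeval m h.reverse) := by
    by_contra hnu
    have hrm : Polynomial.aeval m h.reverse ∈ maximalIdeal R := (IsLocalRing.mem_maximalIdeal _).2 hnu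
    have h1mem : (1 : R) ∈ maximalIdeal R := by
      have := sub_mem hrm hr1
      rwa [sub_sub_cancel] at this
    exact (Ideal.ne_top_iff_one _).1 (Ideal.IsMaximal.ne_top inferInstance) h1mem
  have hxr : x (Polynomial.aeval m h.reverse) = 0 := by
    rw [← Polynomial.aeval_algHom_apply, hQ]
  exact (hru.map x).ne_zero hxr

/-- **A `ℚ̄_p`-point of a local `𝒪_L`-algebra with `R = 𝒪_L + 𝔪_R` is `𝒪_{ℚ̄_p}`-valued.** [folklore] -/
theorem norm_map_le_one (x : R →ₐ[intermediateFieldIntegers p L] PadicAlgCl p)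
    (hres : ∀ r : R, ∃ a : intermediateFieldIntegers p L, r - algebraMap _ R a ∈ maximalIdeal R) (r : R) :
    ‖x r‖ ≤ 1 := by
  obtain ⟨a, ha⟩ := hres r
  have h1 : x r = algebraMap (intermediateFieldIntegers p L) (PadicAlgCl p) a + x (r - algebraMap _ R a) := by
    rw [map_sub, AlgHom.commutes, add_sub_cancel]
  rw [h1]
  refine (IsUltrametricDist.norm_add_le_max _ _).trans (max_le (norm_algebraMap_integers_le_one L a) ?_)
  exact (norm_map_lt_one_of_mem_maximalIdeal L x ha).le

omit [IsScalarTower (intermediateFieldIntegers p L) L (PadicAlgCl p)] [IsLocalRing R] in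
/-- Norm bound on an ideal from a bound on its generators. [folklore] -/
theorem norm_map_le_of_mem_span (x : R →ₐ[intermediateFieldIntegers p L] PadicAlgCl p)
    (hR : ∀ r : R, ‖x r‖ ≤ 1) {G : Set R} {c : ℝ} (hc : 0 ≤ c) (hG : ∀ g ∈ G, ‖x g‖ ≤ c) {a : R}
    (ha : a ∈ Ideal.span G) : ‖x a‖ ≤ c := by
  induction ha using Submodule.span_induction with
  | mem g hg => exact hG g hg
  | zero => rw [map_zero, norm_zero]; exact hc
  | add a b _ _ ha hb => rw [map_add]; exact (IsUltrametricDist.norm_add_le_max _ _).trans (max_le ha hb)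
  | smul r a _ ha =>
    rw [smul_eq_mul, map_mul, norm_mul]
    exact (mul_le_mul (hR r) ha (norm_nonneg _) zero_le_one).trans_eq (one_mul c)

omit [IsScalarTower (intermediateFieldIntegers p L) L (PadicAlgCl p)] [IsLocalRing R] in
/-- Norm bound on powers of an ideal. [folklore] -/
theorem norm_map_le_pow_of_mem_pow (x : R →ₐ[intermediateFieldIntegers p L] PadicAlgCl p)
    {I : Ideal R} {c : ℝ} (hc : 0 ≤ c) (hI : ∀ a ∈ I, ‖x a‖ ≤ c) (N : ℕ) {a : R} (ha : a ∈ I ^ N)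
    (hR : ∀ r : R, ‖x r‖ ≤ 1) : ‖x a‖ ≤ c ^ N := by
  induction N generalizing a with
  | zero => rw [pow_zero]; exact hR a
  | succ N ih =>
    rw [pow_succ] at ha
    refine Submodule.mul_induction_on ha (fun a ha b hb => ?_) (fun a b ha hb => ?_)
    · rw [map_mul, norm_mul, pow_succ]
      exact mul_le_mul (ih ha) (hI b hb) (norm_nonneg _) (pow_nonneg hc _)
    · rw [map_add]
      exact (IsUltrametricDist.norm_add_le_max _ _).trans (max_le ha hb)

end Local

/-! ### The case of `𝒪_L⟦X_{ij}⟧` -/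

section Frame

variable [FiniteDimensional ℚ_[p] L] (n : ℕ)

/-- **Generators of `𝔪₀ = ker (S → k_L)`**: the uniformizer and the variables. [folklore] -/
theorem frameIdeal_eq_span :
    frameIdeal L n = Ideal.span (insert (MvPolynomial.C (intermediateFieldIntegers.uniformizer L))
      (Set.range (MvPolynomial.X : Fin n × Fin n → framePoly L n))) := by
  apply le_antisymm
  · intro f hf
    change frameAug L n f = 0 at hf
    rw [frameAug, MvPolynomial.aeval_zero', IsLocalRing.ResidueField.algebraMap_eq, IsLocalRing.residue_eq_zero_iff,
      intermediateFieldIntegers.maximalIdeal_eq_span_uniformizer, Ideal.mem_span_singleton'] at hf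
    obtain ⟨q, hq⟩ := hf
    have hsplit : f = MvPolynomial.C (MvPolynomial.constantCoeff f) + (f - MvPolynomial.C (MvPolynomial.constantCoeff f)) := by
      ring
    rw [hsplit]
    refine Ideal.add_mem _ ?_ ?_
    · rw [← hq, map_mul]
      exact Ideal.mul_mem_left _ _ (Ideal.subset_span (Set.mem_insert _ _))
    · refine Ideal.span_mono (Set.subset_insert _ _) ?_
      rw [← Set.image_univ, MvPolynomial.mem_ideal_span_X_image]
      intro mono hmono
      have hne : mono ≠ 0 := by
        rintro rfl
        rw [MvPolynomial.mem_support_iff, MvPolynomial.coeff_sub, MvPolynomial.coeff_zero_C] at hmono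
        exact hmono (sub_self _)
      obtain ⟨i, hi⟩ : ∃ i, mono i ≠ 0 := by
        by_contra h
        push Not at h
        exact hne (Finsupp.ext h)
      exact ⟨i, Set.mem_univ _, hi⟩
  · rw [Ideal.span_le]
    rintro f (rfl | ⟨ij, rfl⟩)
    · change frameAug L n _ = 0
      rw [frameAug, MvPolynomial.aeval_C, IsLocalRing.ResidueField.algebraMap_eq, IsLocalRing.residue_eq_zero_iff,
        intermediateFieldIntegers.maximalIdeal_eq_span_uniformizer]
      exact Ideal.mem_span_singleton_self _
    · change frameAug L n _ = 0
      rw [frameAug, MvPolynomial.aeval_X]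

/-- **Generators of the maximal ideal of `𝒪_L⟦X_{ij}⟧`**: the uniformizer `ϖ_L` and the frame
variables `X_{ij}`. [folklore] -/
theorem maximalIdeal_frameRing_eq_span :
    maximalIdeal (frameRing L n) = Ideal.span (insert (algebraMap (intermediateFieldIntegers p L) (frameRing L n)
      (intermediateFieldIntegers.uniformizer L)) (Set.range (frameVar L n))) := by
  rw [maximalIdeal_frameRing]
  refine (congrArg (Ideal.map (algebraMap (framePoly L n) (frameRing L n))) (frameIdeal_eq_span L n)).trans ?_
  rw [Ideal.map_span, Set.image_insert_eq, ← Set.range_comp,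
    show algebraMap (framePoly L n) (frameRing L n) (MvPolynomial.C (intermediateFieldIntegers.uniformizer L)) =
        algebraMap (intermediateFieldIntegers p L) (frameRing L n) (intermediateFieldIntegers.uniformizer L) from by
      rw [IsScalarTower.algebraMap_apply (intermediateFieldIntegers p L) (framePoly L n) (frameRing L n),
        MvPolynomial.algebraMap_eq]]
  rfl

/-- Every element of `𝒪_L⟦X⟧` is an element of `𝒪_L` plus an element of `𝔪`. [folklore] -/
theorem exists_sub_algebraMap_mem_maximalIdeal_frameRing (r : frameRing L n) :
    ∃ a : intermediateFieldIntegers p L, r - algebraMap _ (frameRing L n) a ∈ maximalIdeal (frameRing L n) := by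
  obtain ⟨a, ha⟩ := residue_surjective (frameResidue L n r)
  refine ⟨a, ?_⟩
  rw [mem_maximalIdeal_frameRing_iff, map_sub, AlgHom.commutes, IsLocalRing.ResidueField.algebraMap_eq, ha, sub_self]

variable [Algebra (intermediateFieldIntegers p L) (PadicAlgCl p)]
  [IsScalarTower (intermediateFieldIntegers p L) L (PadicAlgCl p)]

/-- A `ℚ̄_p`-point of `𝒪_L⟦X⟧` is `𝒪_{ℚ̄_p}`-valued. [folklore] -/
theorem norm_framePoint_le_one (x : frameRing L n →ₐ[intermediateFieldIntegers p L] PadicAlgCl p)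
    (r : frameRing L n) : ‖x r‖ ≤ 1 :=
  norm_map_le_one L x (exists_sub_algebraMap_mem_maximalIdeal_frameRing L n) r

/-- **Continuity estimate for `ℚ̄_p`-points of `𝒪_L⟦X⟧`**: there is `c < 1` with `‖x a‖ ≤ cᴺ` for
all `a ∈ 𝔪ᴺ` (take `c` the maximum of `‖x ϖ‖`, `‖x X_{ij}‖`, all `< 1`). [cite: BarnetlambEtAl2014, §1.2] -/
theorem exists_norm_framePoint_pow_le (x : frameRing L n →ₐ[intermediateFieldIntegers p L] PadicAlgCl p) :
    ∃ c : ℝ, 0 ≤ c ∧ c < 1 ∧ ∀ (N : ℕ) (a : frameRing L n), a ∈ maximalIdeal (frameRing L n) ^ N → ‖x a‖ ≤ c ^ N := by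
  classical
  -- the finite set of generators and the maximum of their norms
  let G : Finset (frameRing L n) := insert (algebraMap (intermediateFieldIntegers p L) (frameRing L n)
    (intermediateFieldIntegers.uniformizer L)) (Finset.univ.image (frameVar L n))
  have hGgen : maximalIdeal (frameRing L n) = Ideal.span (G : Set (frameRing L n)) := by
    rw [maximalIdeal_frameRing_eq_span]
    congr 1
    simp [G]
  have hGlt : ∀ g ∈ G, ‖x g‖ < 1 := fun g hg =>
    norm_map_lt_one_of_mem_maximalIdeal L x (hGgen ▸ Ideal.subset_span hg)
  have hGne : G.Nonempty := ⟨_, Finset.mem_insert_self _ _⟩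
  obtain ⟨g₀, hg₀, hmax⟩ := G.exists_max_image (fun g => ‖x g‖) hGne
  refine ⟨‖x g₀‖, norm_nonneg _, hGlt g₀ hg₀, fun N a ha => ?_⟩
  refine norm_map_le_pow_of_mem_pow L x (norm_nonneg _) (fun b hb => ?_) N ha (norm_framePoint_le_one L n x)
  rw [hGgen] at hb
  exact norm_map_le_of_mem_span L x (norm_framePoint_le_one L n x) (norm_nonneg _) (fun g hg => hmax g hg) hb

end Frame

end Literature.NumberTheory.GaloisRepresentations

end
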